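import Mathlib
import HarnessLib
import Summits.BirchSwinnertonDyer.BirchSwinnertonDyer.Theses.ManinLocalTwoThree
import Summits.BirchSwinnertonDyer.BirchSwinnertonDyer.Theorems.ManinLocalTwoThreeUDCLineAtNine
import Summits.BirchSwinnertonDyer.BirchSwinnertonDyer.Theorems.ManinLocalTwoThreeUnboundedDenominatorsWeightOfCDT
import Literature.NumberTheory.Automorphic.UnboundedDenominators
import Summits.BirchSwinnertonDyer.BirchSwinnertonDyer.Theorems.ManinLocalTwoThreeKummerCoverSubgroup
import Summits.BirchSwinnertonDyer.BirchSwinnertonDyer.Theorems.ManinLocalTwoThreeIntegralQSeriesNearCusp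
import Summits.BirchSwinnertonDyer.Rank1Residual.ManinAdditive.UDCKummerWitnessLine
import Summits.BirchSwinnertonDyer.BirchSwinnertonDyer.Theorems.ManinLocalTwoThreeKummerCubeRootThreeBounded
import Summits.BirchSwinnertonDyer.Rank1Residual.ManinAdditive.UDCKummerLine
import Summits.BirchSwinnertonDyer.Rank1Residual.ManinAdditive.UDCKummerLineHolds
import Summits.BirchSwinnertonDyer.BirchSwinnertonDyer.Theorems.ManinLocalTwoThreeKummerCoverNotGammaOne
import Summits.BirchSwinnertonDyer.BirchSwinnertonDyer.Theorems.ManinLocalTwoThreeKummerWitnessInvariance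
import Summits.BirchSwinnertonDyer.BirchSwinnertonDyer.Theorems.ManinLocalTwoThreeKummerWitnessExtensionB
import Summits.BirchSwinnertonDyer.BirchSwinnertonDyer.Theorems.ManinLocalTwoThreeKummerWitnessInvarianceB
import Summits.BirchSwinnertonDyer.BirchSwinnertonDyer.Theorems.ManinLocalTwoThreeKummerPoleValuesAlgebraic
import Summits.BirchSwinnertonDyer.BirchSwinnertonDyer.Theorems.ManinLocalTwoThreeKummerMinimalDictionary
import Summits.BirchSwinnertonDyer.BirchSwinnertonDyer.Theorems.ManinLocalTwoThreeKummerMinimalParamPresentation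
import Summits.BirchSwinnertonDyer.BirchSwinnertonDyer.Theorems.ManinLocalTwoThreeIntegralQSeriesNearCuspB
import Summits.BirchSwinnertonDyer.Rank1Residual.ManinAdditive.UDCKummerWitnessLineB
import Summits.BirchSwinnertonDyer.Rank1Residual.ManinAdditive.UDCKummerLineK
import Summits.BirchSwinnertonDyer.BirchSwinnertonDyer.Theorems.ManinLocalTwoThreeUDCLineKAtNine
import Summits.BirchSwinnertonDyer.BirchSwinnertonDyer.Theorems.ManinLocalTwoThreeUDCLineKByName
import Summits.BirchSwinnertonDyer.Rank1Residual.ManinAdditive.ShimuraThreeTorsion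
import Summits.BirchSwinnertonDyer.BirchSwinnertonDyer.Theorems.ManinLocalTwoThreeShimuraThreeTorsionAtNine
import Summits.BirchSwinnertonDyer.BirchSwinnertonDyer.Theorems.ManinLocalTwoThreeUnboundedDenominatorsWeightAlgIntOfCDT
import Summits.BirchSwinnertonDyer.BirchSwinnertonDyer.Theorems.ManinLocalTwoThreeUDCBLineComposition
import Literature.NumberTheory.EllipticCurves.KatoAdditiveTwistedValueNeronIntegralityThreeKPForms
import Summits.BirchSwinnertonDyer.BirchSwinnertonDyer.Theorems.ManinLocalTwoThreeKLineThreeBoundedKSplit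
import Summits.BirchSwinnertonDyer.BirchSwinnertonDyer.Theorems.ManinLocalTwoThreeShimuraThreeTorsionCoprimeTotient
import Summits.BirchSwinnertonDyer.BirchSwinnertonDyer.Theorems.ManinLocalTwoThreeKLineSigmaComposition
import Summits.BirchSwinnertonDyer.BirchSwinnertonDyer.Theorems.ManinLocalTwoThreeKLineANKByName
import Summits.BirchSwinnertonDyer.BirchSwinnertonDyer.Theorems.ManinLocalTwoThreeShimuraKernelAtkinLehnerSigns
import Summits.BirchSwinnertonDyer.BirchSwinnertonDyer.Theorems.ManinLocalTwoThreeShimuraQuotientFrickeParity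
import Summits.BirchSwinnertonDyer.BirchSwinnertonDyer.Theorems.ManinLocalTwoThreeCThreeOfSixPrintedFacts
import Literature.NumberTheory.EllipticCurves.Gamma1ParametrizationCuspZeroGaloisOrbit

/-!
# v34 CANDIDATE (width prover p3 g17, 2026-08-29T21:0xZ; = an g41's L-an-g41-1 step 3, for the NEXT C3 LEAD to register): v33 VERBATIM except that the
# last non-printed stub `stub_shimuraThreeKernelForcesRationalThreeTorsionAtNine` (E-an-221) is now DERIVED (no sorry) from FOUR PRINTED statement-only
# Literature facts — `stub_Fstar0 : optimalParametrization_cuspZero_rational` (Cremona 1997 §2.6 / Edixhoven, T-an-50 p741081), `stub_Fstar :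
# optimalGamma1Parametrization_cusp_rational` (CES 2003 §6.1.2), `stub_Fnat : optimalGamma1Parametrization_cuspZero_galoisConjugate` (Stevens 1982
# Thm 1.3.1 (b), T-an-53 p742727; ref1 §R196 faithful/printed), `stub_CES : exists_optimal_gamma1ParametrizationData` (CES 2003) — through the tree
# theorem `SixPrintedFacts.shimuraThreeKernelForcesRationalThreeTorsionAtNine_of_print` (p744210 = an FILE 1 p743609 ∘ an FILE Θ p743718 ∘ F♮).
# STUBS (6, ALL PRINTED, cite-only): stub_katoFactThreeKP, stub_CDT_algInt, stub_Fstar0, stub_Fstar, stub_Fnat, stub_CES.  Sorry-free tree image of the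
# whole composition: `SixPrintedFacts.maninPrimeToThreeAtNine_of_sixPrintedFacts` (p744210).  C3 is NOT proved unconditionally; BSD is not proved.
#
# Lines/kato_shift_three.lean — v33 (lead p1 gen 17, 2026-08-29T20:3xZ): (AN♮)_K IS A THEOREM BY NAME — p2 g18's `KLine.kummerCubeRootCongruenceOfBoundedKOfUDC_holds`
# (`Theorems/ManinLocalTwoThreeKLineANKByName.lean` p741727 = `KLine.kummerCubeRootCongruenceOfBoundedKOfUDC_of_minimalCubeRootK` p736048 ∘ p3 g16's (INT)_K
# `MinimalCubeRootC.exists_algInt_minimalCubeRootC`, landed as `…KLineMinimalCubeRootAlgInt` p741499).  STUBS (3): {F₃♮ `stub_katoFactThreeKP` (PRINTED), CDT-algInt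
# `stub_CDT_algInt` (PRINTED), E-an-221 `stub_shimuraThreeKernelForcesRationalThreeTorsionAtNine` (cell conjecture)} — EVERY CELL PIECE OF THE LINE IS A THEOREM; C3 is
# CLOSED MODULO two printed theorems and ONE conjecture, whose habitat the lead's g17 files pin UNCONDITIONALLY: `…ShimuraThreeTorsionCoprimeTotient` (3 ∣ φ(N/3)),
# `…ShimuraThreeKernelLine` (u ∉ Λ_E automatic, Λ₁ = ℤ(3u/c)+3Λ₀ exactly, ū+u ∈ Λ_E, Y₀² = r < 0), `…ShimuraQuotientFrickeParity` (w_N f = f ⟹ Λ₁ = Λ₀: root number +1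
# forced), `…ShimuraQuotientAtkinLehnerParity` + `…ShimuraKernelAtkinLehnerSigns` (EXACTLY ONE Atkin–Lehner minus prime power p₀^e, with 3 ∣ φ(p₀^e): p₀ ≡ 1 (3) or
# p₀ = 3, e ≥ 3).  Tree image: `KLineSigma.maninPrimeToThreeAtNine_of_katoFactKP_of_CDT_algInt_of_sigmaTorsion : F₃♮ → CDT-algInt → E-an-221 → C3` (`…KLineSigmaClosed`).
# HONEST FRAMING: CONDITIONAL reduction; C3, Manin's conjecture and BSD are NOT proved.  v32 text:
# Lines/kato_shift_three.lean — v32 (lead p1 gen 17, 2026-08-29T19:5xZ): (BI)_K IS A THEOREM BY NAME — p2 g18's `KLineBI.kummerCubeRootThreeBoundedK_holds`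
# (`Theorems/ManinLocalTwoThreeKLineThreeBoundedKSplit.lean` p740441, with the v30 header `stub_kummerCubeRootThreeBoundedK`; non-split core P3 p739124 +
# P4 p739974 over `QuadraticAlgebra ℚ_[3] r₃ 0`, split core p740199 via the two ℚ₃-embeddings; p3 g16's `CubeSystemDescent`; p2's `kummerTripling_of_subring`).
# STUBS (4): {F₃♮ `stub_katoFactThreeKP` (PRINTED), CDT-algInt `stub_CDT_algInt` (PRINTED), (AN♮)_K `stub_kummerCubeRootCongruenceOfBoundedKOfUDC` (p2's by-name
# file = `KLine.kummerCubeRootCongruenceOfBoundedKOfUDC_of_minimalCubeRootK` ∘ p3's MAIN (INT)_K `MinimalCubeRootC.exists_algInt_minimalCubeRootC`, whose landing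
# waits ONLY for the farm build of `…CubeRootComponents` (p737513/p737534) — kernel content done), E-an-221 `stub_shimuraThreeKernelForcesRationalThreeTorsionAtNine`
# (cell conjecture; HABITAT PINNED unconditionally by the lead g17: `…ShimuraThreeTorsionCoprimeTotient` p740101 — a Shimura third-period needs 3 ∣ φ(N/3), none at
# N = 9M with 3 ∤ φ(3M) — and `…ShimuraThreeKernelLine` p740531 — u ∉ Λ_E automatic, Λ₁(f) = ℤ(3u/c) + 3Λ₀(f) exactly, ū + u ∈ Λ_E, Y₀² = r < 0; E-an-221 ⟺
# «index [Λ₀:Λ₁] = 3 ⟹ 3 ∣ #E₀(ℚ)_tors» ⟺ «the X₁-side curve of a Shimura 3-cover has a₃ ∈ ℚˣ³ in Q-normal form», L-p1-g17-1)}.  Tree image of v30/v31 BY NAME: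
# `KLineSigma.maninPrimeToThreeAtNine_of_katoFactKP_of_CDT_algInt_of_kPieces_sigmaTorsion` (p740223).  v31 (= v30 with (AN♮)_K by name, text HOME/p1/g16) is
# SKIPPED as a registration: it needs p3's MAIN in the tree; v33 := v32 + (AN♮)_K by name = {F₃♮, CDT-algInt, E-an-221} the minute MAIN lands.
# HONEST FRAMING: CONDITIONAL reduction; C3, Manin's conjecture and BSD are NOT proved.  v30 text:
# Lines/kato_shift_three.lean — v30 (lead p1 gen 16, 2026-08-29T18:4xZ): THE SHIMURA BRANCH OF THE K-LINE IS EMPTIED BY E-an-221 (-an g39 file F, MEMO-an §83.11,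
# ask L-an-g39-3): RES₃♭ ⟸ EXISTC ∧ (BI)_K ∧ (AN♮)_K ∧ UDW-algInt ∧ E-an-221 (`noRationalThreeTorsionCoprimeIsolatedResidual_of_kPieces_sigmaTorsion_udc`,
# `Theorems/ManinLocalTwoThreeShimuraThreeTorsionAtNine.lean`, landed by the lead p737849; statement layer `ManinAdditive/ShimuraThreeTorsion.lean` T-an-49) —
# on an optimal curve a Shimura 3-kernel FORCES a rational point of order 3 (Mazur's Σ/C duality at prime level; census 27a1/54a1), contradicting RES₃♭'s own
# hypothesis, so GENΣ, E-an-201, DICTΣ, RESΣ are all BYPASSED (they remain in the tree as theorems/nodes; v29 = the E-an-201/RESΣ split is kept for the record).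
# STUBS (5): {F₃♮ `stub_katoFactThreeKP` (PRINTED), CDT-algInt `stub_CDT_algInt` (PRINTED), (BI)_K `stub_kummerCubeRootThreeBoundedK` (p2/p3: split case via
# two ℚ₃-embeddings, non-split via `QuadraticAlgebra ℚ_[3] r₃ 0` + p2's `kummerTripling_of_subring` p736306 + p3's `CubeSystemDescent` p736149 — GO),
# (AN♮)_K `stub_kummerCubeRootCongruenceOfBoundedKOfUDC` (p2 g18; (INT)_K p3 p737534), E-an-221 `stub_shimuraThreeKernelForcesRationalThreeTorsionAtNine`
# (cell conjecture: prime-level theorem (Mazur/Emerton) + finite census; ref1 R-an-77)}.  EXISTC is the lead's theorem BY NAME.  HONEST FRAMING: CONDITIONAL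
# reduction; C3, Manin's conjecture and BSD are NOT proved.  v29 text:
# Lines/kato_shift_three.lean — v29 (lead p1 gen 16, 2026-08-29T18:0xZ): THE RESIDUAL RES₃♭ SPLIT ALONG -an g39's K-LINE (MEMO-an §82)
# `ManinAdditive/UDCKummerLineK.lean` (ty g21 T-an-47) + `Theorems/ManinLocalTwoThreeUDCLineKAtNine.lean` (-an PART B/C, landed by the lead p735594):
# RES₃♭ ⟸ EXISTC ∧ GENΣ ∧ KLINE ∧ RESΣ, KLINE ⟸ NCΣ ∧ (BI)_K ∧ (AN)_K, (AN)_K ⟸ (AN♮)_K ∧ ∀k UDW-algInt k, GENΣ ⟸ E-an-201 (DICTΣ proved).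
# THEOREMS BY NAME: EXISTC `KummerCover.reducibleShortThreeTorsionLiftC_holds` (lead p735052 + wrapper), NCΣ `kummerCoverNoncongruenceOfNotShimura_holds` (an),
# DICTΣ `kummerShimuraLattice_holds` (an), GENΣ on the REAL locus `KummerCover.kummerNotShimuraOfGeneric_of_im_eq_zero` (lead p734511, unconditional; the
# imaginary non-μ₃ locus via E-an-201), UDW-algInt ⟸ CDT-algInt `UDWOfCDT.unboundedDenominatorsWeightAlgInt_of_CDT_algInt` (p2 p734175), CDT ⟸ CDT-algInt
# (`CalegariDimitrovTang2025_unboundedDenominators_of_algInt`, Literature).  STUBS (6): {F₃♮ `stub_katoFactThreeKP` (PRINTED), CDT-algInt `stub_CDT_algInt`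
# (PRINTED: CDT Thm 1.0.1 + Rem. 58–59; replaces `stub_CDT`, now derived), E-an-201 `stub_shimuraKernelMuTypeAtNine` (PRINTED SHADOW: Ling–Oesterlé 1991
# Thm 1, Σ(N) μ-type), (BI)_K `stub_kummerCubeRootThreeBoundedK` (M/L, UNOWNED — p3-style ℤ₃⟦q⟧ cube mechanism over O_{K,𝔭}), (AN♮)_K
# `stub_kummerCubeRootCongruenceOfBoundedKOfUDC` (L, p2 g18 TAKING: K-line dictionary C-files p734431/p735126 + (INT)_K p3), RESΣ `stub_shimuraMuThreeCaseAtNine`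
# (= Manin on the Shimura stratum = Stevens fragment E-an-200 ∧ 3 ∤ c₁; OPEN; habitat empty among the residual classes N ≤ 5000)}.
# NET EFFECT vs v28: the census residual RES₃♭ is replaced by two printed shadows (CDT-algInt ⊇ CDT, E-an-201), two analytic K-pieces in progress, and the
# sharper residual RESΣ.  HONEST FRAMING: CONDITIONAL reduction; C3, Manin's conjecture and BSD are NOT proved.  v28 text:
# Lines/kato_shift_three.lean — v28 (lead p1 gen 16, 2026-08-29T17:0xZ): THE WITNESS LAW IS A THEOREM — ALL SIX B-LINE PIECES BY NAME
# (INT) p728452 (p3) · (DICT) p733079 (lead) · (RATB) p733689 (p3, `ParamPoleJ.kummerMinimalParamPresentation_holds`) · (HOLB) p731758 (p2) · (QEXNB) p732744 (lead)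
# · (INVB) p731884 (p2) ⟹ WL♭ `KummerCubeRootModularFormWitnessNearCusp`, hence (AN♮) `KummerCubeRootCongruenceOfBoundedOfUDC`, hence (with NC-a, NC-b@9, BI,
# KL18 — theorems) the whole UDC line of -an g37/g38 is KERNEL-CHECKED modulo its ONE printed input CDT.  THE ANALYTIC CONTENT OF C3'S REDUCIBLE
# RESIDUAL IS CLOSED.  STUBS (3, none analytic): {F₃♮ `stub_katoFactThreeKP` = Kato's p = 3 divisibility in Kosters–Pannekoek form (PRINTED, statement-only
# Literature def), CDT `stub_CDT` = Calegari–Dimitrov–Tang 2025 Thm 1.0.1 (PRINTED, statement-only Literature def), RES₃♭ `stub_noRationalThreeTorsionCoprimeIsolatedResidual`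
# = the census residual (an instance of Manin's conjecture on the χ₋₃-only / isolated locus; OPEN)}.  C3 is therefore CLOSED MODULO {F₃♮, CDT, RES₃♭}: two
# printed theorems not yet proved in the tree and one open residual.  The sorry-free image `F₃♮ → CDT → (RATB) → RES₃♭ → C3` is the lead's
# `Theorems/ManinLocalTwoThreeUDCBLineComposition.lean` (p733914).  HONEST FRAMING: CONDITIONAL reduction; C3, Manin's conjecture and BSD are NOT proved.  v27 text:
# Lines/kato_shift_three.lean — v27 (lead p1 gen 16, 2026-08-29T16:5xZ): THE WITNESS LAW WL♭ NOW RUNS ON -an's B-LINE (`UDCKummerWitnessLineB.lean`, p730675)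
# with FIVE of its six pieces THEOREMS BY NAME — (INT) p728452 (p3), (DICT) p733079 (lead p1 g16, `MinimalDictionary.kummerMinimalDictionary_holds`),
# (HOLB) p731758 (p2, `WitnessInvariance.kummerMinimalWitnessExtensionB_holds`), (QEXNB) p732744 (lead, `IntegralQSeries.integralQSeriesNearCuspB_holds`),
# (INVB) p731884 (p2, `WitnessInvariance.kummerMinimalWitnessInvarianceB_holds`) — leaving ONE analytic stub, (RATB) `stub_kummerMinimalParamPresentation`
# [p3 g16 TAKING 16:25Z: t_W∘φ = Bn/Bd with Bd ∈ M_{12m}(Γ₀(N)) ∩ ℤ⟦q⟧ via `mapLaurent_xFn`/`mapLaurent_yFn` + integer basis + the lead's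
# `exists_int_of_complex_solution`].  The P(j)-line of v25/v26 is kept as the ALTERNATIVE (its (ALG) is p3's theorem p731971, (DICT)/(QEXN)/(INV) are
# theorems; only (EXT) would remain) but is no longer on the composition path, so `stub_kummerMinimalWitnessExtension` is DROPPED from the stub list.
# STUBS (4): {F₃♮ `stub_katoFactThreeKP` (printed Kato fact), CDT `stub_CDT` (printed, cite-only), RATB `stub_kummerMinimalParamPresentation` (M, p3),
# RES₃♭ `stub_noRationalThreeTorsionCoprimeIsolatedResidual` (census residual)}.  When (RATB) lands the skeleton is CLOSED MODULO the two printed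
# inputs and the residual.  HONEST FRAMING unchanged: CONDITIONAL reduction; C3, Manin's conjecture and BSD are NOT proved.  v26 text:
# Lines/kato_shift_three.lean — v26 (lead p1 gen 16, 2026-08-29T16:2xZ): v25 with (INV) CLOSED BY NAME — p2 g17's
# `WitnessInvariance.kummerMinimalWitnessInvariance_holds` (p731378) replaces `stub_kummerMinimalWitnessInvariance`.  STUBS (6): {F₃♮, CDT, ALG [p3 g16],
# DICT [lead p1 g16], EXT [p2: B-line (HOLB)+(INVB)+(RATB) fallback by name, `…_of_piecesB`], RES₃♭}.  Five of -an's witness pieces are now theorems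
# by name: (INT) p728452, (QEXN) p730250, (QXP) p730253, (INV) p731378, glue p729478.  HONEST FRAMING unchanged: CONDITIONAL reduction; C3, Manin's
# conjecture and BSD are NOT proved.  v25 text:
# Lines/kato_shift_three.lean — v25 (lead p1 gen 15, 2026-08-29T16:1xZ): THE WITNESS STUB SPLIT BY NAME along -an g38's typed witness line
# `ManinAdditive/UDCKummerWitnessLine.lean` (T-an-44, p729921): WL♭ (= v24's stub VERBATIM, now the named `@[conjecture]` `KummerCubeRootModularFormWitnessNearCusp`)
# := `kummerCubeRootModularFormWitnessNearCusp_of_pieces` (INT) (ALG) (DICT) (EXT) (QEXN) (INV), with THREE pieces already THEOREMS consumed by name —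
# (INT) `IntegralQSeries.minimalKummerCubeRootIntegral_holds` (p3 g15 p728452), (QEXN) `IntegralQSeries.integralQSeriesNearCusp_holds` (lead, p730250),
# (QXP) `…qExpansionExtensionPrinciple_holds` (lead, p729478; not needed for WL♭) — and FOUR OPEN pieces as stubs: (ALG) `stub_kummerPoleValuesAlgebraic`
# [p3 g16 TAKING as a theorem], (DICT) `stub_kummerMinimalDictionary` [p2: minimal-block version of AN2-b], (EXT) `stub_kummerMinimalWitnessExtension`
# [removable singularities + cusp growth; p3's annihilator-order route / p2's presentation route], (INV) `stub_kummerMinimalWitnessInvariance` [p2 AN2-c +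
# lead's WitnessSlashAlgebra p729721 + identity theorem].  Witness: F = κ·(t_W∘φ)·W_{u,e}(c·ℰ_f)·(Δ^{deg P}P(j))ⁿ, weight 12·n·deg P.  STUBS (7 = stubs_max):
# {F₃♮, CDT, ALG, DICT, EXT, INV, RES₃♭}.  S69-type rationality cites are NOT needed (lead's RationalDescent p729755).  HONEST FRAMING unchanged: CONDITIONAL
# reduction; C3, Manin's conjecture and BSD are NOT proved.  v24 text:
# Lines/kato_shift_three.lean — v24 (lead p1 gen 15, 2026-08-29T15:5xZ): v23 with clause (5) of the witness stub RELAXED to an integer q-series valid for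
# Im τ > B only (`∃ b B, ∀ τ, B < τ.im → HasSum …`) — the extension to all of ℍ is the lead's theorem `QExpansionExtension.hasSum_of_hasSum_of_lt_im`
# (p729478: periodicity by the identity theorem, boundedness at i∞, uniqueness of the power series of the cusp function), consumed through the relaxed glue
# `UDCGlue.kummerCubeRootCongruenceOfBoundedOfUDC_of_modularFormWitness_of_lt_im`.  p2's AN2-b (p727852) delivers exactly the relaxed clause.  Stubs unchanged
# otherwise: {F₃♮, CDT cite, MF-witness (relaxed), RES₃♭}.  v23 text:
# Lines/kato_shift_three.lean — v23 (lead p1 gen 15, 2026-08-29T15:04Z): v22 with the content stub AN♮ RESHAPED into the MODULAR-FORM WITNESS LAW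
# `stub_kummerCubeRootModularFormWitness` (inline; = the analytic content of MEMO-an §80.12 step (6): for every bounded normalised cube root of Θ_T a
# holomorphic F : ℍ → ℂ of some weight with integer q-expansion, exponential growth at the cusps and stabiliser in Γ₀(N) EXACTLY Γ_T), the UDC
# bookkeeping being the landed glue `kummerCubeRootCongruenceOfBoundedOfUDC_of_modularFormWitness` (p727487, uses NC-a).  Stubs: {F₃♮, CDT cite,
# MF-witness, RES₃♭}.  p2's AN2-a (cube-root q-dictionary, p727203) and p3's AN1 (integrality) are the first pieces of the witness.  v22 text:
# Lines/kato_shift_three.lean — v22 (lead p1 gen 15, 2026-08-29T15:2xZ): v21 with the cite stub RE-POINTED to the Literature fact itself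
# `stub_CDT : Literature.NumberTheory.Automorphic.CalegariDimitrovTang2025_unboundedDenominators` (p2 g17's `UDWOfCDT.unboundedDenominatorsWeight_of_CDT`,
# p726609, derives -an's all-weights rendering from the vendored CDT theorem); composition `UDWOfCDT.maninPrimeToThreeAtNine_of_katoFactKP_of_CDT_udcNine_of_coprimeIsolated`.
# Stubs: {F₃♮, CDT (Literature cite), AN♮, RES₃♭}.  v21 text (kept for the record):
# Lines/kato_shift_three.lean — v21 (lead p1 gen 15, 2026-08-29T14:5xZ): THE UDC LINE (an g37, MEMO-an §80.12) IN PLACE OF E-an-57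
v21 = v20 − `stub_cuspidalKummerCubeRepresentative` (E-an-57, the open research node) + the UDC branch in the director's RESTUB SHAPE:
ONE pure-cite stub `stub_unboundedDenominators` (Calegari–Dimitrov–Tang 2025 Thm 1.0.1 «unbounded denominators», all weights; PRINTED,
statement-only tree def `UDCKummerLine.UnboundedDenominatorsWeight`) + ONE content stub (AN♮) `stub_kummerCubeRootCongruenceOfBoundedOfUDC`
(BY NAME; the real content: packaging UDC on `F = D′ρ⁻¹h·P(j)^eΔ^k`); every other UDC piece is a THEOREM consumed by name: Kurth–Long Prop. 18
(`UDCKummerLine.typeIINoncongruence_holds`, typer g20, from Wohlfahrt), (NC-a) `kummerCoverSubgroup_holds` (lead p1 g15), (NC-b)@9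
`KummerCover.exists_mem_gamma1_not_kummerPeriodTrivial` (p3 g15, from the lead's `no_rational_kernel_generator`), (BI)
`KummerCubeRootBounded.kummerCubeRoot_threeAdicallyBounded` (p3 g15).  F₃♮ (printed Kato fact) and RES₃♭ unchanged.  COMPOSITION: the lead's `maninPrimeToThreeAtNine_of_katoFactKP_of_udcNine_of_coprimeIsolated`
(`Theorems/ManinLocalTwoThreeUDCLineAtNine.lean`: NC@9 ⟸ TypeII ∧ NC-a ∧ NC-b@9; `ReducibleCaseAtNine` ⟸ NC@9 ∧ BI ∧ AN; RAT₃; then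
`…_of_katoFactKP_of_ratThreeTorsion_of_coprimeIsolated`).  THE OPEN CONTENT OF C3 after v21 = FOUR stubs: F₃♮ (printed Kato fact), UDC (printed, cite-only),
AN♮ (content, L), RES₃♭ (census residual).  HONEST FRAMING: CONDITIONAL reduction; C3, Manin's conjecture and BSD are NOT proved; UDC and Kurth–Long are
printed inputs consumed as hypotheses, never proved here.
# v20 text (kept for the record): v20 = v19 with stub P79 CLOSED BY NAME (σ-monodromy chain); stubs {F₃♮, E-an-57, RES₃♭}.
-/

set_option autoImplicit false
set_option linter.dupNamespace false

noncomputable section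

open scoped Classical MatrixGroups ModularForm UpperHalfPlane Manifold
open PowerSeries CongruenceSubgroup WeierstrassCurve Literature.NumberTheory.EllipticCurves
  Literature.NumberTheory.EllipticCurves.ModularForms
  Summit.BirchSwinnertonDyer.Rank1Residual.ManinAdditive
  Summit.BirchSwinnertonDyer.Rank1Residual.ManinAdditive.CuspidalKummer
  Summit.BirchSwinnertonDyer.Rank1Residual.ManinAdditive.CuspidalKummerThree
  Summit.BirchSwinnertonDyer.Rank1Residual.ManinAdditive.UDCKummerLine
  Summit.BirchSwinnertonDyer.BirchSwinnertonDyer.Theorems.ManinLocalTwoThree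

namespace Summit.BirchSwinnertonDyer.BirchSwinnertonDyer.Cruxes.ManinPrimeToThreeAtNine.KatoShiftThree

/-- STUB 1 — Kato's `p = 3` fact in Kosters–Pannekoek form F₃♮ BY NAME (Literature `def`, statement-only, printed; unchanged since v18). -/
theorem stub_katoFactThreeKP : kato_neron_isIntegral_twistedSymbolSum_of_additive_three_kp := by
  sorry

/-- STUB 2 (v29) — THE PRINTED INPUT OF BOTH UDC LINES, algebraic-integer version: Calegari–Dimitrov–Tang 2025 Thm. 1.0.1 with Remarks 58–59
(`Literature.NumberTheory.Automorphic.CalegariDimitrovTang2025_unboundedDenominators_algInt`, vendored statement-only fact).  The ℤ-version `stub_CDT` of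
v22–v28 is DERIVED (`CalegariDimitrovTang2025_unboundedDenominators_of_algInt`), and p2's `UDWOfCDT.unboundedDenominatorsWeightAlgInt_of_CDT_algInt`
(p734175) gives -an's `∀ k, UnboundedDenominatorsWeightAlgInt k`.  CITE-ONLY. -/
theorem stub_CDT_algInt : Literature.NumberTheory.Automorphic.CalegariDimitrovTang2025_unboundedDenominators_algInt := by
  sorry

/-- CDT (ℤ-version) DERIVED from the algebraic-integer version (Literature `…_of_algInt`). -/
theorem CDT_of_stub : Literature.NumberTheory.Automorphic.CalegariDimitrovTang2025_unboundedDenominators :=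
  Literature.NumberTheory.Automorphic.CalegariDimitrovTang2025_unboundedDenominators_of_algInt stub_CDT_algInt

open Summit.BirchSwinnertonDyer.Rank1Residual.ManinAdditive.UDCKummerLineK in
/-- UDW-algInt in every weight, DERIVED (p2 g18 p734175; -an's `UnboundedDenominatorsWeightAlgInt k` unfolds to p2's conclusion verbatim). -/
theorem udw_algInt_of_stub : ∀ k : ℤ, UnboundedDenominatorsWeightAlgInt k :=
  fun k ↦ UDWOfCDT.unboundedDenominatorsWeightAlgInt_of_CDT_algInt stub_CDT_algInt k

/-- (NC-b)@9 — a THEOREM, consumed by name (p3 g15, `…KummerCoverNotGammaOne.lean`: `KummerCover.exists_mem_gamma1_not_kummerPeriodTrivial`,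
from the lead's μ₃-type theorem `no_rational_kernel_generator`; the binders `u ∉ Λ_E`, `c³℘'(u)/2 = Y₀` are not needed). -/
theorem kummerCoverNotGammaOneAtNine_of_tree :
    ∀ (W : WeierstrassCurve ℚ) [W.IsElliptic] [W.IsGloballyMinimal] {N : ℕ} [NeZero N]
      (D : ModularParametrizationData W N),
      (∀ z ∈ D.L.lattice, ∃ w ∈ periodLattice D.f, z = D.c * w) → 9 ∣ N →
      ∀ X₀ Y₀ : ℚ, IsShortThreeTorsion W D.c X₀ Y₀ →
      ∀ u : ℂ, u ∉ D.L.lattice → 3 * u ∈ D.L.lattice →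
      (D.c : ℂ) ^ 2 * D.L.weierstrassP u = (X₀ : ℂ) → (D.c : ℂ) ^ 3 * D.L.derivWeierstrassP u / 2 = (Y₀ : ℂ) →
      ∃ γ : Gamma0 N, (γ : SL(2, ℤ)) ∈ Gamma1 N ∧ ¬ KummerPeriodTrivial D u γ :=
  fun W _ _ _ _ D hopt h9 X₀ Y₀ hT u _ h3u hX _ ↦
    KummerCover.exists_mem_gamma1_not_kummerPeriodTrivial W D h9 hopt X₀ Y₀ hT u h3u hX

/-! ### STUB 3 of v23/v24 (the witness law WL♭ `UDCKummerWitnessLine.KummerCubeRootModularFormWitnessNearCusp`) — v27: B-LINE BY NAME -/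

open Summit.BirchSwinnertonDyer.Rank1Residual.ManinAdditive.UDCKummerWitnessLine in
/-- (RATB) `KummerMinimalParamPresentation` — a THEOREM since v28 (p3 g16, p733689, `Theorems/ManinLocalTwoThreeKummerMinimalParamPresentation.lean`:
`t_W∘φ = B_n/B_d` with `B_d ∈ M_{12m}(Γ₀(N)) ∩ ℤ⟦q⟧`, explicit `x`/`y` presentations + `exists_int_cuspForm_presentation`). -/
theorem kummerMinimalParamPresentation_of_tree : KummerMinimalParamPresentation :=
  ParamPoleJ.kummerMinimalParamPresentation_holds

open Summit.BirchSwinnertonDyer.Rank1Residual.ManinAdditive.UDCKummerWitnessLine in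
/-- (ALG) `KummerPoleValuesAlgebraic` — a THEOREM since v27 (p3 g16, p731971, `Theorems/ManinLocalTwoThreeKummerPoleValuesAlgebraic.lean`); not on the
B-line composition path, recorded for the P(j) alternative. -/
theorem kummerPoleValuesAlgebraic_of_tree : KummerPoleValuesAlgebraic :=
  ParamPoleJ.kummerPoleValuesAlgebraic_holds

open Summit.BirchSwinnertonDyer.Rank1Residual.ManinAdditive.UDCKummerWitnessLine in
/-- (DICT) `KummerMinimalDictionary` — a THEOREM since v27 (lead p1 g16, p733079, `Theorems/ManinLocalTwoThreeKummerMinimalDictionary.lean` + prelims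
p732527: AN2-b for the given lift, the `q`-germs of `t_s` and `t_W∘φ` with Taylor series `z`, `z_W`, the `dslope` quotient germ). -/
theorem kummerMinimalDictionary_of_tree : KummerMinimalDictionary :=
  MinimalDictionary.kummerMinimalDictionary_holds

open Summit.BirchSwinnertonDyer.Rank1Residual.ManinAdditive.UDCKummerWitnessLine in
/-- (INV) `KummerMinimalWitnessInvariance` — a THEOREM since v26 (p2 g17, p731378); P(j) alternative only. -/
theorem kummerMinimalWitnessInvariance_of_tree : KummerMinimalWitnessInvariance :=
  WitnessInvariance.kummerMinimalWitnessInvariance_holds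

open Summit.BirchSwinnertonDyer.Rank1Residual.ManinAdditive.UDCKummerWitnessLine in
/-- WL♭ DERIVED (no sorry) ON THE B-LINE: -an's `kummerCubeRootModularFormWitnessNearCusp_of_piecesB` fed with (INT) `IntegralQSeries.minimalKummerCubeRootIntegral_holds`,
(DICT) `MinimalDictionary.kummerMinimalDictionary_holds`, (RATB) `ParamPoleJ.kummerMinimalParamPresentation_holds`, (HOLB) `WitnessInvariance.kummerMinimalWitnessExtensionB_holds`, (QEXNB)
`IntegralQSeries.integralQSeriesNearCuspB_holds`, (INVB) `WitnessInvariance.kummerMinimalWitnessInvarianceB_holds`. -/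
theorem kummerCubeRootModularFormWitnessNearCusp_of_stubs : KummerCubeRootModularFormWitnessNearCusp :=
  kummerCubeRootModularFormWitnessNearCusp_of_piecesB IntegralQSeries.minimalKummerCubeRootIntegral_holds kummerMinimalDictionary_of_tree
    kummerMinimalParamPresentation_of_tree WitnessInvariance.kummerMinimalWitnessExtensionB_holds IntegralQSeries.integralQSeriesNearCuspB_holds
    WitnessInvariance.kummerMinimalWitnessInvarianceB_holds

/-- (AN♮) DERIVED (no sorry): the lead's RELAXED UDC glue (p729478 ∘ p727487) applied to WL♭ (the named law unfolds to the glue's hypothesis verbatim). -/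
theorem kummerCubeRootCongruenceOfBoundedOfUDC_of_stub : KummerCubeRootCongruenceOfBoundedOfUDC :=
  UDCGlue.kummerCubeRootCongruenceOfBoundedOfUDC_of_modularFormWitness_of_lt_im kummerCubeRootModularFormWitnessNearCusp_of_stubs

/-! ### STUB 4 of v10–v28 (RES₃♭ `NoRationalThreeTorsionCoprimeIsolatedResidual`) SPLIT ALONG THE K-LINE, Shimura branch emptied by E-an-221 (v30) -/

open Summit.BirchSwinnertonDyer.Rank1Residual.ManinAdditive.UDCKummerLineK in
/-- (BI)_K `KummerCubeRootThreeBoundedK` — a THEOREM since v32 (p2 g18, p740441 `Theorems/ManinLocalTwoThreeKLineThreeBoundedKSplit.lean`: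
`KLineBI.kummerCubeRootThreeBoundedK_holds`, by cases on «Y₀² is a square in ℚ₃»: split core p740199 + non-split P3/P4 p739124/p739974). -/
theorem kummerCubeRootThreeBoundedK_of_tree : KummerCubeRootThreeBoundedK :=
  KLineBI.kummerCubeRootThreeBoundedK_holds

open Summit.BirchSwinnertonDyer.Rank1Residual.ManinAdditive.UDCKummerLineK in
/-- (AN♮)_K `KummerCubeRootCongruenceOfBoundedKOfUDC` — a THEOREM since v33 (p2 g18 `KLine.kummerCubeRootCongruenceOfBoundedKOfUDC_holds`, p741727:
`KLine.kummerCubeRootCongruenceOfBoundedKOfUDC_of_minimalCubeRootK` p736048 ∘ p3's (INT)_K `MinimalCubeRootC.exists_algInt_minimalCubeRootC` p741499). -/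
theorem kummerCubeRootCongruenceOfBoundedKOfUDC_of_tree : KummerCubeRootCongruenceOfBoundedKOfUDC :=
  KLine.kummerCubeRootCongruenceOfBoundedKOfUDC_holds

/-- STUB (v34) F★₀ — PRINTED, statement-only (Cremona 1997 §2.6 p.19; Edixhoven §1; T-an-50 p741081). -/
theorem stub_Fstar0 : optimalParametrization_cuspZero_rational := by
  sorry

/-- STUB (v34) F★ — PRINTED, statement-only (Conrad–Edixhoven–Stein 2003 §6.1.2). -/
theorem stub_Fstar : optimalGamma1Parametrization_cusp_rational := by
  sorry

/-- STUB (v34) F♮ — PRINTED, statement-only (Stevens 1982 Thm 1.3.1 (b); T-an-53 p742727; ref1 §R196). -/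
theorem stub_Fnat : optimalGamma1Parametrization_cuspZero_galoisConjugate := by
  sorry

/-- STUB (v34) CES — PRINTED, statement-only (Conrad–Edixhoven–Stein 2003: an optimal X₁(N)-datum exists). -/
theorem stub_CES : exists_optimal_gamma1ParametrizationData := by
  sorry

open Summit.BirchSwinnertonDyer.Rank1Residual.ManinAdditive.UDCKummerLineK
  Summit.BirchSwinnertonDyer.Rank1Residual.ManinAdditive.ShimuraThreeTorsion in
/-- E-an-221 `ShimuraThreeKernelForcesRationalThreeTorsionAtNine` (v33's STUB 4e, the cell conjecture) is DERIVED in v34 (no sorry of its own):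
`SixPrintedFacts.shimuraThreeKernelForcesRationalThreeTorsionAtNine_of_print` (p744210 = an FILE 1 p743609 ∘ an FILE Θ p743718 ∘ F♮ p742727) fed with the
four printed stubs F★₀, F★, F♮, CES.  (Its unconditional HABITAT — lead g17's 13 `SigmaHabitat` files — stays in the tree as information about Σ(N)[3].) -/
theorem shimuraThreeKernelForcesRationalThreeTorsionAtNine_of_stubs : ShimuraThreeKernelForcesRationalThreeTorsionAtNine :=
  SixPrintedFacts.shimuraThreeKernelForcesRationalThreeTorsionAtNine_of_print stub_Fstar0 stub_Fstar stub_Fnat stub_CES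

open Summit.BirchSwinnertonDyer.Rank1Residual.ManinAdditive.UDCKummerLineK in
/-- RES₃♭ DERIVED (no sorry of its own): -an's `noRationalThreeTorsionCoprimeIsolatedResidual_of_kPieces_sigmaTorsion_udc` (file F PART B, p737849) fed with
EXISTC BY NAME (`KummerCover.reducibleShortThreeTorsionLiftC_holds`, lead p736545), the stubs (BI)_K, (AN♮)_K, E-an-221 and UDW-algInt (⟸ CDT-algInt). -/
theorem noRationalThreeTorsionCoprimeIsolatedResidual_of_stubs : NoRationalThreeTorsionCoprimeIsolatedResidual :=
  noRationalThreeTorsionCoprimeIsolatedResidual_of_kPieces_sigmaTorsion_udc KummerCover.reducibleShortThreeTorsionLiftC_holds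
    kummerCubeRootThreeBoundedK_of_tree kummerCubeRootCongruenceOfBoundedKOfUDC_of_tree udw_algInt_of_stub
    shimuraThreeKernelForcesRationalThreeTorsionAtNine_of_stubs

/-- (NC-a) — a THEOREM, consumed by name (lead p1 g15, `…KummerCoverSubgroup.lean`). -/
theorem kummerCoverSubgroup_of_tree : KummerCoverSubgroup := kummerCoverSubgroup_holds

/-- (BI) — a THEOREM, consumed by name (p3 g15, `…KummerCubeRootThreeBounded.lean`; `IsThreeAdicallyBounded` unfolds definitionally). -/
theorem kummerCubeRootThreeBounded_of_tree : KummerCubeRootThreeBounded :=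
  fun W _ _ _ _ D a ha h9 X₀ Y₀ hT z hz h3c ↦
    KummerCubeRootBounded.kummerCubeRoot_threeAdicallyBounded W D a ha h9 X₀ Y₀ hT z hz h3c

/-- COMPOSITION (no sorry): p2's `UDWOfCDT.maninPrimeToThreeAtNine_of_katoFactKP_of_CDT_udcNine_of_coprimeIsolated` (CDT cite ⟹ ∀k UDC_k ∧ KL18 ⟹ the lead's
`…_of_katoFactKP_of_udcNine_of_coprimeIsolated`) fed with the stub F₃♮, the derived CDT (⟸ CDT-algInt), the derived RES₃♭ (⟸ (BI)_K ∧ (AN♮)_K ∧ E-an-221, EXISTC/NCΣ theorems), the THEOREM (AN♮) and the theorems NC-a, NC-b@9, BI. -/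
theorem ManinPrimeToThreeAtNine_of :
    Summit.BirchSwinnertonDyer.BirchSwinnertonDyer.Theses.ManinLocalTwoThree.ManinPrimeToThreeAtNine :=
  UDWOfCDT.maninPrimeToThreeAtNine_of_katoFactKP_of_CDT_udcNine_of_coprimeIsolated stub_katoFactThreeKP CDT_of_stub
    kummerCoverSubgroup_of_tree kummerCoverNotGammaOneAtNine_of_tree kummerCubeRootThreeBounded_of_tree
    kummerCubeRootCongruenceOfBoundedOfUDC_of_stub noRationalThreeTorsionCoprimeIsolatedResidual_of_stubs

end Summit.BirchSwinnertonDyer.BirchSwinnertonDyer.Cruxes.ManinPrimeToThreeAtNine.KatoShiftThree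

end
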